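import Summits.QuantumFields.GaugeBoot.EquipartitionFunctional
import HarnessLib

/-!
# Gauge-boot: the equipartition bound holds at EVERY FEASIBLE POINT of the lane's `SU(N)` word SDP of level `≥ 4`
# (large-`N` supplement 18, part 5d)

HONEST FRAMING (cell `pub-gaugeboot`, page 1 of every file): certified bounds on lattice
expectations at STATED coupling, gauge group, dimension and torus size; NOT a mass gap, NOT a
continuum limit, NOT a string tension, NOT large `N`; NOT Yang–Mills-summit-bearing (barriers
`FixedCouplingUltralocality`, `PerturbativeInvisibility`).  A statement about the cell's SDPs themselves (an a-priori
ceiling on what they can certify for the edge-averaged plaquette); it certifies no number of CERTIFIED.md.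

## Content

The lane's truncated bootstrap (`BootstrapConvergence.IsBootstrapFeasible r k S β V φ`: `φ 1 = 1`, `0 ≤ φ(v²)` for
`v ∈ V`, and the one-link Schwinger–Dyson rows `φ f' = β φ(f·S')` for `f ∈ V`) with `r` the fundamental representation
of `SU(N)`, `k = suExp` (all traceless skew-Hermitian directions), `S` the Wilson action and `V = wordTruncation n`
(words of length `≤ n` in the link entries — Anderson–Kruczenski / Kazakov–Zheng level `n`):

* `entriesIn_stepIns`, `entriesIn_insDeriv` — the insertion derivative of a word holonomy has word entries of the
  word's length (so its traces are admissible derivative test functions);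
* ★★ `sdPairF_of_isBootstrapFeasible_suN` — a level-`n` feasible `φ` has the PAIR ROWS of part 5a for every word of
  length `≤ n` and every traceless direction (rows for `f = Re/Im tr(Y ρ(hol_w))`, uniqueness of the action
  derivative `S' = actionDeriv = −½ plaqIns`, then polarisation);
* ★★★ `sum_wordLoop_le_of_isBootstrapFeasible_suN` — **for `N ≥ 2`, `d ≥ 2`, `L ≥ 2`, `β ≥ 0` (tree coupling) and
  every functional `φ` feasible for the `SU(N)` word SDP at any level `n ≥ 4`:
  `Σ_{ν≠μ, ε} φ(W(P̃_{ν,ε})) ≤ 2(d−1)·(1 − (N − 1/N)/(4(d−1)β + N − 1/N))`**, `W = (1/N) Re tr hol` the lane's loop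
  variable (`wordLoopCM`): the average of the `2(d−1)` plaquette variables through any edge is bounded, at every
  feasible point, by the equipartition value — so no certificate of the cell at level `≥ 4` can put the (symmetrised)
  plaquette above `1 − (N² − 1)/(4(D−1)β_std + N² − 1)`, and the Wilson value (feasible at every level,
  `isBootstrapFeasible_wilson_suN`) obeys it, recovering part 4b.
[folklore]
-/

noncomputable section

open Filter Topology NormedSpace
open scoped Matrix.Norms.Frobenius Matrix
open Literature.MathematicalPhysics.QuantumFieldTheory
open Literature.MathematicalPhysics.QuantumLattice (fundamentalLatticeRep fundamentalRep fundamentalLatticeRep_N)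
open Summit.QuantumFields.YangMills.Cruxes.CurvatureAmnesia.WardDefect.SchwingerDyson

namespace Summit.QuantumFields.GaugeBoot

/-! ## The insertion derivative has word entries -/

section Entries

variable {d L : ℕ} {G : Type} [Group G] [TopologicalSpace G] (r : LatticeRep G)

/-- The one-step insertion `stepIns` (`X ρ(U_e)`, `ρ(U_e⁻¹)(−X)` or `0`) has entries of degree `1`. [folklore] -/
theorem entriesIn_stepIns (e : Edge d L) (X : Matrix (Fin r.N) (Fin r.N) ℂ) (x : Site d L) (s : Step d) :
    EntriesIn r (Set.univ : Set (Edge d L)) 1 (fun U : GaugeConfig d L G => stepIns r.ρ e X U x s) := by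
  have hfwd : EntriesIn r (Set.univ : Set (Edge d L)) 1 (fun U : GaugeConfig d L G => X * r.ρ (U e)) := by
    simpa using (entriesIn_const r (Set.univ : Set (Edge d L)) 0 X).mul r (entriesIn_rho r (Set.mem_univ e) le_rfl)
  have hbwd : EntriesIn r (Set.univ : Set (Edge d L)) 1 (fun U : GaugeConfig d L G => r.ρ ((U e)⁻¹) * (-X)) := by
    simpa using (entriesIn_rho_inv r (Set.mem_univ e) le_rfl).mul r (entriesIn_const r (Set.univ : Set (Edge d L)) 0 (-X))
  have hzero : EntriesIn r (Set.univ : Set (Edge d L)) 1 (fun _ : GaugeConfig d L G => (0 : Matrix (Fin r.N) (Fin r.N) ℂ)) :=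
    entriesIn_const r _ 1 0
  cases s with
  | fwd ν =>
    by_cases h : ((x, ν) : Edge d L) = e
    · have hfun : (fun U : GaugeConfig d L G => stepIns r.ρ e X U x (.fwd ν)) = fun U => X * r.ρ (U e) := by
        funext U; rw [stepIns, Step.edge_fwd, if_pos h, Step.isFwd_fwd, if_pos rfl]
      rw [hfun]; exact hfwd
    · have hfun : (fun U : GaugeConfig d L G => stepIns r.ρ e X U x (.fwd ν)) = fun _ => 0 := by
        funext U; rw [stepIns, Step.edge_fwd, if_neg h]
      rw [hfun]; exact hzero
  | bwd ν =>
    by_cases h : ((x - Pi.single ν 1, ν) : Edge d L) = e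
    · have hfun : (fun U : GaugeConfig d L G => stepIns r.ρ e X U x (.bwd ν)) = fun U => r.ρ ((U e)⁻¹) * (-X) := by
        funext U; rw [stepIns, Step.edge_bwd, if_pos h, Step.isFwd_bwd, if_neg (by decide)]
      rw [hfun]; exact hbwd
    · have hfun : (fun U : GaugeConfig d L G => stepIns r.ρ e X U x (.bwd ν)) = fun _ => 0 := by
        funext U; rw [stepIns, Step.edge_bwd, if_neg h]
      rw [hfun]; exact hzero

/-- ★ **The insertion derivative of `ρ(hol_w)` has word entries of degree `|w|`.** [folklore] -/
theorem entriesIn_insDeriv (e : Edge d L) (X : Matrix (Fin r.N) (Fin r.N) ℂ) :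
    ∀ (x : Site d L) (w : Word d),
      EntriesIn r (Set.univ : Set (Edge d L)) w.length (fun U : GaugeConfig d L G => insDeriv r.ρ e X U x w)
  | x, [] => by
    simpa only [insDeriv_nil, List.length_nil] using entriesIn_const r (Set.univ : Set (Edge d L)) 0 0
  | x, s :: w => by
    have h1 := (entriesIn_stepIns r e X x s).mul r (entriesIn_wordHolonomy r (s.apply x) w)
    have h2 := (entriesIn_stepHolonomy r x s).mul r (entriesIn_insDeriv e X (s.apply x) w)
    have h := h1.add r h2
    rw [Nat.add_comm] at h
    simpa only [insDeriv_cons, List.length_cons] using h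

end Entries

/-! ## Feasible functionals of the `SU(N)` word SDP have the pair rows -/

section SuN

variable {d L N : ℕ}

/-- ★★ **A level-`n` feasible functional of the `SU(N)` word SDP has the pair rows** (part 5a's `SDPairF`) for every
word of length `≤ n` and every traceless direction `X`. [folklore] -/
theorem sdPairF_of_isBootstrapFeasible_suN [NeZero L] {n : ℕ} {β : ℝ}
    {φ : C(GaugeConfig d L (Matrix.specialUnitaryGroup (Fin N) ℂ), ℝ) →ₗ[ℝ] ℝ}
    (hφ : IsBootstrapFeasible (fundamentalLatticeRep N) (suExp N) (fun _ => wilsonAction (fundamentalRep (Fin N))) β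
      (wordTruncation (ι := Edge d L) (fundamentalLatticeRep N) n) φ)
    (x : Site d L) (μ : Fin d) (x₀ : Site d L) (w : Word d) (hw : w.length ≤ n)
    (X : Matrix (Fin N) (Fin N) ℂ) (hX0 : X.trace = 0) : SDPairF (fundamentalLatticeRep N) φ β x μ x₀ w X := by
  refine sdPairF_of_traceless (fundamentalLatticeRep N) φ β x μ x₀ w (fun Z hZs hZ0 => ?_) X hX0
  clear hX0 X
  -- the direction as a generator of `SU(N)`
  have hZskew : (Z : Matrix (Fin N) (Fin N) ℂ) ∈ skewAdjoint (Matrix (Fin N) (Fin N) ℂ) := by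
    change star Z = -Z
    rw [Matrix.star_eq_conjTranspose]; exact hZs
  let Zg : SuGenerator N := ⟨Z, hZskew, hZ0⟩
  have hk : ∀ s t, suExp N Zg (s + t) = suExp N Zg s * suExp N Zg t := suExp_add N Zg
  have hkX : ∀ t, (fundamentalLatticeRep N).ρ (suExp N Zg t) = exp ((t : ℂ) • Z) := fun t => rho_suExp N Zg t
  -- the action derivative of the feasibility witness is `actionDeriv`
  obtain ⟨S', -, hS'der, hrows⟩ := hφ.2.2 (x, μ) Zg
  have hS' : ∀ U, S' U = actionDeriv (fundamentalLatticeRep N).ρ (x, μ) Z U := fun U =>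
    (hS'der U).unique (hasDerivAt_wilsonAction (e := (x, μ)) hk hkX U)
  intro Y
  -- the test functions `Re/Im tr(Y ρ(hol_w))` and their derivatives `Re/Im tr(Y insDeriv)` are word functions
  have hV : EntriesIn (fundamentalLatticeRep N) (Set.univ : Set (Edge d L)) w.length
      (fun U : GaugeConfig d L _ => Y * (fundamentalLatticeRep N).ρ (wordHolonomy U x₀ w)) := by
    simpa using (entriesIn_const (fundamentalLatticeRep N) (Set.univ : Set (Edge d L)) 0 Y).mul (fundamentalLatticeRep N)
      (entriesIn_wordHolonomy (fundamentalLatticeRep N) x₀ w)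
  have hD : EntriesIn (fundamentalLatticeRep N) (Set.univ : Set (Edge d L)) w.length
      (fun U : GaugeConfig d L _ => Y * insDeriv (fundamentalLatticeRep N).ρ (x, μ) Z U x₀ w) := by
    simpa using (entriesIn_const (fundamentalLatticeRep N) (Set.univ : Set (Edge d L)) 0 Y).mul (fundamentalLatticeRep N)
      (entriesIn_insDeriv (fundamentalLatticeRep N) (x, μ) Z x₀ w)
  obtain ⟨gre, hgre, hgre'⟩ := (mem_wordFunctions_iff (fundamentalLatticeRep N)).1 hV.trace_re
  obtain ⟨gim, hgim, hgim'⟩ := (mem_wordFunctions_iff (fundamentalLatticeRep N)).1 (hV.trace_im (fundamentalLatticeRep N))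
  obtain ⟨dre, hdre, hdre'⟩ := (mem_wordFunctions_iff (fundamentalLatticeRep N)).1 hD.trace_re
  obtain ⟨dim, hdim, hdim'⟩ := (mem_wordFunctions_iff (fundamentalLatticeRep N)).1 (hD.trace_im (fundamentalLatticeRep N))
  have hgreV : gre ∈ wordTruncation (ι := Edge d L) (fundamentalLatticeRep N) n :=
    wordTruncation_mono (fundamentalLatticeRep N) hw (mem_wordTruncation_of_mem_wordSpace (fundamentalLatticeRep N) hgre)
  have hgimV : gim ∈ wordTruncation (ι := Edge d L) (fundamentalLatticeRep N) n :=
    wordTruncation_mono (fundamentalLatticeRep N) hw (mem_wordTruncation_of_mem_wordSpace (fundamentalLatticeRep N) hgim)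
  -- the derivative facts along the shift `U ↦ U[e ↦ e^{tZ} U_e]` (chain rule with a real-linear map)
  have hder_re : ∀ U : GaugeConfig d L (Matrix.specialUnitaryGroup (Fin N) ℂ),
      HasDerivAt (fun t : ℝ => gre (Function.update U (x, μ) (suExp N Zg t * U (x, μ)))) (dre U) 0 := by
    intro U
    have h1 := hasDerivAt_wordHolonomy (e := (x, μ)) hk hkX U x₀ w
    have h2 := (Complex.reCLM.comp (traceMulLeftCLM Y)).hasFDerivAt.comp_hasDerivAt (0 : ℝ) h1
    have e1 : (fun t : ℝ => gre (Function.update U (x, μ) (suExp N Zg t * U (x, μ)))) =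
        (⇑(Complex.reCLM.comp (traceMulLeftCLM Y)) ∘ fun t : ℝ =>
          (fundamentalLatticeRep N).ρ (wordHolonomy (Function.update U (x, μ) (suExp N Zg t * U (x, μ))) x₀ w)) := by
      funext t
      simp only [Function.comp_apply, ContinuousLinearMap.comp_apply, traceMulLeftCLM_apply, Complex.reCLM_apply, hgre']
    have e2 : dre U = (Complex.reCLM.comp (traceMulLeftCLM Y)) (insDeriv (fundamentalLatticeRep N).ρ (x, μ) Z U x₀ w) := by
      simp only [ContinuousLinearMap.comp_apply, traceMulLeftCLM_apply, Complex.reCLM_apply, hdre']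
    rw [e1, e2]
    exact h2
  have hder_im : ∀ U : GaugeConfig d L (Matrix.specialUnitaryGroup (Fin N) ℂ),
      HasDerivAt (fun t : ℝ => gim (Function.update U (x, μ) (suExp N Zg t * U (x, μ)))) (dim U) 0 := by
    intro U
    have h1 := hasDerivAt_wordHolonomy (e := (x, μ)) hk hkX U x₀ w
    have h2 := (Complex.imCLM.comp (traceMulLeftCLM Y)).hasFDerivAt.comp_hasDerivAt (0 : ℝ) h1
    have e1 : (fun t : ℝ => gim (Function.update U (x, μ) (suExp N Zg t * U (x, μ)))) =
        (⇑(Complex.imCLM.comp (traceMulLeftCLM Y)) ∘ fun t : ℝ =>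
          (fundamentalLatticeRep N).ρ (wordHolonomy (Function.update U (x, μ) (suExp N Zg t * U (x, μ))) x₀ w)) := by
      funext t
      simp only [Function.comp_apply, ContinuousLinearMap.comp_apply, traceMulLeftCLM_apply, Complex.imCLM_apply, hgim']
    have e2 : dim U = (Complex.imCLM.comp (traceMulLeftCLM Y)) (insDeriv (fundamentalLatticeRep N).ρ (x, μ) Z U x₀ w) := by
      simp only [ContinuousLinearMap.comp_apply, traceMulLeftCLM_apply, Complex.imCLM_apply, hdim']
    rw [e1, e2]
    exact h2
  -- the rows
  have hrow_re := hrows gre hgreV dre (mem_polyAlgebra_of_mem_wordSpace (fundamentalLatticeRep N) hdre) hder_re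
  have hrow_im := hrows gim hgimV dim (mem_polyAlgebra_of_mem_wordSpace (fundamentalLatticeRep N) hdim) hder_im
  -- the right-hand side `tr(Y ρ(hol_w))·(−½ plaqIns_Z)` is `tr(Y ρ(hol_w))·S'` (a real factor)
  have hrhs : ∀ U, (Y * (fundamentalLatticeRep N).ρ (wordHolonomy U x₀ w)).trace *
      (-(1 / 2) * plaqIns (fundamentalLatticeRep N).ρ Z U x μ) =
      (Y * (fundamentalLatticeRep N).ρ (wordHolonomy U x₀ w)).trace * ((S' U : ℝ) : ℂ) := fun U => by
    rw [hS' U, actionDeriv_eq_plaqIns hZs (fundamentalLatticeRep N).mem_unitary U x μ]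
  have hLre : evalR φ (fun U => ((Y * insDeriv (fundamentalLatticeRep N).ρ (x, μ) Z U x₀ w).trace).re) = φ dre := by
    rw [← hdre', evalR_coe]
  have hLim : evalR φ (fun U => ((Y * insDeriv (fundamentalLatticeRep N).ρ (x, μ) Z U x₀ w).trace).im) = φ dim := by
    rw [← hdim', evalR_coe]
  have hRre : evalR φ (fun U => ((Y * (fundamentalLatticeRep N).ρ (wordHolonomy U x₀ w)).trace *
      (-(1 / 2) * plaqIns (fundamentalLatticeRep N).ρ Z U x μ)).re) = φ (gre * S') := by
    have e1 : (fun U => ((Y * (fundamentalLatticeRep N).ρ (wordHolonomy U x₀ w)).trace *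
        (-(1 / 2) * plaqIns (fundamentalLatticeRep N).ρ Z U x μ)).re) = ⇑(gre * S') := by
      funext U
      rw [hrhs U, Complex.re_mul_ofReal, ContinuousMap.mul_apply, hgre']
    rw [e1, evalR_coe]
  have hRim : evalR φ (fun U => ((Y * (fundamentalLatticeRep N).ρ (wordHolonomy U x₀ w)).trace *
      (-(1 / 2) * plaqIns (fundamentalLatticeRep N).ρ Z U x μ)).im) = φ (gim * S') := by
    have e1 : (fun U => ((Y * (fundamentalLatticeRep N).ρ (wordHolonomy U x₀ w)).trace *
        (-(1 / 2) * plaqIns (fundamentalLatticeRep N).ρ Z U x μ)).im) = ⇑(gim * S') := by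
      funext U
      rw [hrhs U, Complex.im_mul_ofReal, ContinuousMap.mul_apply, hgim']
    rw [e1, evalR_coe]
  apply Complex.ext
  · rw [evalC_re, hLre, Complex.re_ofReal_mul, evalC_re, hRre, hrow_re]
  · rw [evalC_im, hLim, Complex.im_ofReal_mul, evalC_im, hRim, hrow_im]

/-- ★★★ **THE EQUIPARTITION BOUND AT EVERY FEASIBLE POINT OF THE `SU(N)` WORD SDP.**  For `N ≥ 2`, `d ≥ 2`, a torus of
side `L ≥ 2`, tree coupling `β ≥ 0`, and every functional `φ` feasible for the lane's `SU(N)` word-level-`n` bootstrap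
with `n ≥ 4`:
`Σ_{ν≠μ, ε} φ(W(P̃_{ν,ε})) ≤ 2(d−1)·(1 − (N − 1/N)/(4(d−1)β + N − 1/N))`, `W = (1/N) Re tr hol` (`wordLoopCM`). [folklore] -/
theorem sum_wordLoop_le_of_isBootstrapFeasible_suN [NeZero L] (hN : 2 ≤ N) {n : ℕ} (hn : 4 ≤ n)
    (hL : (1 : ZMod L) ≠ 0) (hd : 2 ≤ d) {β : ℝ} (hβ : 0 ≤ β)
    {φ : C(GaugeConfig d L (Matrix.specialUnitaryGroup (Fin N) ℂ), ℝ) →ₗ[ℝ] ℝ}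
    (hφ : IsBootstrapFeasible (fundamentalLatticeRep N) (suExp N) (fun _ => wilsonAction (fundamentalRep (Fin N))) β
      (wordTruncation (ι := Edge d L) (fundamentalLatticeRep N) n) φ)
    (x : Site d L) (μ : Fin d) :
    (∑ ν ∈ Finset.univ.erase μ, ∑ ε : Bool, φ (wordLoopCM (fundamentalLatticeRep N) x (plaqWord μ ν ε))) ≤
      2 * ((d : ℝ) - 1) * (1 - ((N : ℝ) - 1 / N) / (4 * ((d : ℝ) - 1) * β + ((N : ℝ) - 1 / N))) := by
  have hN2 : (1 : ℝ) < ((fundamentalLatticeRep N).N : ℝ) ^ 2 := by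
    rw [fundamentalLatticeRep_N]
    have : (2 : ℝ) ≤ N := by exact_mod_cast hN
    nlinarith
  have hP : ∀ ν ∈ Finset.univ.erase μ, ∀ (ε : Bool) (i j : Fin (fundamentalLatticeRep N).N),
      SDPairF (fundamentalLatticeRep N) φ β x μ x (plaqWord μ ν ε) (unitDir ((1 : ℝ) : ℂ) i j) := by
    intro ν _ ε i j
    rw [Complex.ofReal_one]
    exact sdPairF_of_isBootstrapFeasible_suN hφ x μ x (plaqWord μ ν ε) ((length_plaqWord μ ν ε).trans_le hn) _
      (trace_unitDir_one i j)
  have h := Equipartition.sum_evalR_plaquette_le_of_sdPairF (fundamentalLatticeRep N) φ hL hd hβ x μ zero_le_one hN2 hn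
    hφ.1 hφ.2.1 hP
  have hev : ∀ ν ε, evalR φ (fun U => ((fundamentalLatticeRep N).N : ℝ)⁻¹ *
      ((fundamentalLatticeRep N).ρ (wordHolonomy U x (plaqWord μ ν ε))).trace.re) =
      φ (wordLoopCM (fundamentalLatticeRep N) x (plaqWord μ ν ε)) := fun ν ε => by
    have e1 : (fun U => ((fundamentalLatticeRep N).N : ℝ)⁻¹ *
        ((fundamentalLatticeRep N).ρ (wordHolonomy U x (plaqWord μ ν ε))).trace.re) =
        ⇑(wordLoopCM (fundamentalLatticeRep N) x (plaqWord μ ν ε)) := by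
      funext U; rw [wordLoopCM_apply, wordLoop]
    rw [e1, evalR_coe]
  simp only [hev] at h
  simpa [fundamentalLatticeRep_N] using h

/-- The same for the AVERAGE over the `2(d−1)` plaquettes through the edge:
`(1/(2(d−1)))·Σ φ(W(P̃_{ν,ε})) ≤ 1 − (N − 1/N)/(4(d−1)β + N − 1/N)`. [folklore] -/
theorem avg_wordLoop_le_of_isBootstrapFeasible_suN [NeZero L] (hN : 2 ≤ N) {n : ℕ} (hn : 4 ≤ n)
    (hL : (1 : ZMod L) ≠ 0) (hd : 2 ≤ d) {β : ℝ} (hβ : 0 ≤ β)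
    {φ : C(GaugeConfig d L (Matrix.specialUnitaryGroup (Fin N) ℂ), ℝ) →ₗ[ℝ] ℝ}
    (hφ : IsBootstrapFeasible (fundamentalLatticeRep N) (suExp N) (fun _ => wilsonAction (fundamentalRep (Fin N))) β
      (wordTruncation (ι := Edge d L) (fundamentalLatticeRep N) n) φ)
    (x : Site d L) (μ : Fin d) :
    (2 * ((d : ℝ) - 1))⁻¹ *
        (∑ ν ∈ Finset.univ.erase μ, ∑ ε : Bool, φ (wordLoopCM (fundamentalLatticeRep N) x (plaqWord μ ν ε))) ≤
      1 - ((N : ℝ) - 1 / N) / (4 * ((d : ℝ) - 1) * β + ((N : ℝ) - 1 / N)) := by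
  have hd0 : (0 : ℝ) < 2 * ((d : ℝ) - 1) := by
    have : (2 : ℝ) ≤ d := by exact_mod_cast hd
    linarith
  rw [inv_mul_le_iff₀ hd0]
  exact sum_wordLoop_le_of_isBootstrapFeasible_suN hN hn hL hd hβ hφ x μ

end SuN

end Summit.QuantumFields.GaugeBoot

end
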